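import Literature.NumberTheory.Automorphic.RegularAlgebraicCuspidalHeckePointProofs
import Summits.Langlands.Langlands.Theorems.ParityBlindBianchiTwoAdicBianchiProModularityLevelSupportDevissage
import Summits.Langlands.Langlands.Theses.ParityBlindBianchi
import HarnessLib

/-!
# `TwoAdicBianchiProModularityLevel` (crux stmt-Langlands-15110, route `ParityBlindBianchi`) —
# RESIDUAL SUPPORT: a point of `Spf 𝕋(Kᵖ)` puts its maximal ideal in the Hecke support of ONE
# finite-level cohomology group with `k/ϖ`-coefficients

Generic vocabulary of `CompletedCohomology` (`Γ → 𝒢`, tower `T`, Hecke elements `δ : J → 𝒢`,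
coefficients `k`, `ϖ`) and the support dévissage of `…SupportDevissage` ("`χ mod 𝔭` is supported on
`H`": every non-commutative polynomial in the operators vanishing on `H` has `P(χ) ∈ 𝔭`, written out
in full).

* §4 **Bockstein reduction in the tower** (`ϖ` a non-zero-divisor, `𝔭` prime): by the exact sequence
  `0 → k/ϖ^t —ϖ→ k/ϖ^{t+1} → k/ϖ → 0`, support on the piece `H^i(X_{K(s)}, k/ϖ^{t+1})` forces support
  on `H^i(X_{K(s)}, k/ϖ^t)` or on `H^i(X_{K(s)}, k/ϖ)` (`supp_piece_or_of_supp_piece_succ`), hence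
  support on any piece `H^i(X_{K(s)}, k/ϖ^t)`, `t ≥ 1`, forces support on `H^i(X_{K(s)}, k/ϖ)` — same
  degree, same level (`supp_piece_one_of_supp_piece`); the pieces `t = 0` are zero and carry nothing
  (`not_supp_piece_zero`).
* §5 **Points of `Spf 𝕋(Kᵖ)`**: if `χ` is a point (`IsHeckePoint`) and `ϖ ∈ 𝔭`, stage `1` of
  `isHeckePoint_iff_forall_freeAlgebra` puts `χ mod 𝔭` in the support of finitely many pieces, hence
  (§1 of `…SupportDevissage`) of one piece, hence (§4) of ONE piece `H^i(X_{K(s)}, k/ϖ)` with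
  `k/ϖ`-coefficients (`IsHeckePoint.exists_supp_piece`, `IsHeckePoint.exists_supp_piece_one`).
* §6 **The crux** (`k = ℤ̄₂`, `ϖ = 2`, `𝔭 = 𝔪_{ℤ̄₂}`; registered sub-goal `crux_residualSupport`): the
  occurrence hypothesis of stub B (`stub_artinLift`: an integral point `b` of `Spf 𝕋(U₀²)` of the
  `2`-power Bianchi tower with `‖b − a‖ < 1` at every good place) yields `i, s` such that `a mod 𝔪` —
  the eigensystem of `σ̄` — is in the Hecke support of the single Bianchi cohomology group
  `H^i(X_{U₀ ∩ K((2)^s)}, ℤ̄₂/2) = H^i(X_{U₀K(2^s)}, 𝔽₂) ⊗ ℤ̄₂` (`crux_residualSupport`,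
  `residualSupport_of_artinLift_hypotheses`).  This is literally the hypothesis "`𝔪` a maximal ideal of
  `𝕋(U₀²)` in the support of `H^i(X_{U₀K_2(2^s)}, 𝒪/ϖ)`" with which the Calegari–Geraghty / Gee–Newton
  big `R = 𝕋` statements begin: B is such a statement read at the Artin point of the icosahedral `σ`,
  with no further input hidden in its hypothesis (and no weaker reading available: `not_supp_piece_zero`,
  `nontrivial_of_supp` — the supporting group is a genuinely non-zero `H^i` of a Bianchi congruence
  subgroup with `𝔽₂`-type coefficients).

Sorry-free, definition-free; lead c10 (line `Sketch`, cycle 11).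

## References

* F. Calegari, M. Emerton, *Completed cohomology — a survey*, LMS LN 393 (2012), §8
  [CalegariEmerton2011].
* T. Gee, J. Newton, *Patching and the completed homology of locally symmetric spaces*, JIMJ 21
  (2022), §5.1, Conj. 60 [GeeNewton2020]; F. Calegari, D. Geraghty, Invent. Math. 211 (2018), §1
  [CalegariGeraghty2017].
* K. S. Brown, *Cohomology of Groups*, GTM 87 (1982), III §6 (Bockstein) [Brown1982CohomologyGroups].
-/

noncomputable section

set_option linter.dupNamespace false

namespace Summit.Langlands.Langlands.Theorems.TwoAdicBianchiProModularityLevel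

open CategoryTheory Literature.NumberTheory.Automorphic

universe v

/-! ### §4 Bockstein reduction in the tower: from `k/ϖ^t`-pieces to the `k/ϖ`-piece -/

section Tower

variable {k : Type} [CommRing k] {Γ 𝒢 : Type} [Group Γ] [Group 𝒢]
  {ι : Γ →* 𝒢} {T : LevelTower 𝒢} {ϖ : k} {J : Type v} {δ : J → 𝒢} {χ : J → k} {𝔭 : Ideal k}

/-- Multiplication by `ϖ` induces `k/ϖ^t → k/ϖ^{t+1}` (well defined). [folklore] -/
theorem span_pow_le_comap_lsmul (ϖ : k) (t : ℕ) :
    (Ideal.span {ϖ ^ t} : Submodule k k) ≤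
      Submodule.comap (LinearMap.lsmul k k ϖ) (Ideal.span {ϖ ^ (t + 1)}) := by
  intro x hx
  obtain ⟨r, rfl⟩ := Ideal.mem_span_singleton'.1 hx
  rw [Submodule.mem_comap, LinearMap.lsmul_apply, smul_eq_mul]
  exact Ideal.mem_span_singleton'.2 ⟨r, by ring⟩

/-- `(ϖ^{t+1}) ≤ (ϖ^1)`. [folklore] -/
theorem span_pow_succ_le_span_pow_one (ϖ : k) (t : ℕ) :
    Ideal.span {ϖ ^ (t + 1)} ≤ Ideal.span {ϖ ^ 1} :=
  Ideal.span_singleton_le_span_singleton.2 (pow_dvd_pow ϖ (Nat.le_add_left 1 t))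

variable (ι T δ χ) in
/-- **One Bockstein step.**  For `ϖ` a non-zero-divisor of `k` the sequence
`0 → k/ϖ^t —ϖ→ k/ϖ^{t+1} → k/ϖ → 0` is exact, so for `𝔭` prime: if `χ mod 𝔭` is supported on the
piece `H^i(X_{K(s)}, k/ϖ^{t+1})` of the tower then it is supported on `H^i(X_{K(s)}, k/ϖ^t)` or on
`H^i(X_{K(s)}, k/ϖ)` (same degree, same level). [cite: Brown1982CohomologyGroups, III §6 Prop. 6.1] -/
theorem supp_piece_or_of_supp_piece_succ (h𝔭 : 𝔭.IsPrime) (hϖ : ϖ ∈ nonZeroDivisors k)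
    (i s t : ℕ)
    (h : ∀ P : FreeAlgebra k J,
      FreeAlgebra.lift k (fun j => towerHeckeFamily k ι T ϖ (δ j) (i, s, t + 1)) P = 0 →
        FreeAlgebra.lift k χ P ∈ 𝔭) :
    (∀ P : FreeAlgebra k J,
      FreeAlgebra.lift k (fun j => towerHeckeFamily k ι T ϖ (δ j) (i, s, t)) P = 0 →
        FreeAlgebra.lift k χ P ∈ 𝔭) ∨
    ∀ P : FreeAlgebra k J,
      FreeAlgebra.lift k (fun j => towerHeckeFamily k ι T ϖ (δ j) (i, s, 1)) P = 0 →
        FreeAlgebra.lift k χ P ∈ 𝔭 := by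
  -- the maps of the Bockstein sequence
  refine supp_coeff_X₁_or_X₃ ι (T.level s)
    (Submodule.mapQ (Ideal.span {ϖ ^ t}) (Ideal.span {ϖ ^ (t + 1)}) (LinearMap.lsmul k k ϖ)
      (span_pow_le_comap_lsmul ϖ t))
    (Submodule.factor (span_pow_succ_le_span_pow_one ϖ t)) δ χ ?_ ?_ ?_ ?_ h𝔭 i h
  · -- injective: `ϖ x ∈ (ϖ^{t+1}) ⇒ x ∈ (ϖ^t)` as `ϖ` is a non-zero-divisor
    rw [injective_iff_map_eq_zero]
    intro x hx
    induction x using Submodule.Quotient.induction_on with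
    | H x =>
      rw [Submodule.mapQ_apply, Submodule.Quotient.mk_eq_zero, LinearMap.lsmul_apply,
        smul_eq_mul] at hx
      obtain ⟨r, hr⟩ := Ideal.mem_span_singleton'.1 hx
      rw [Submodule.Quotient.mk_eq_zero]
      refine Ideal.mem_span_singleton'.2 ⟨r, ?_⟩
      have h0 : (r * ϖ ^ t - x) * ϖ = 0 := by linear_combination hr
      exact sub_eq_zero.1 ((mem_nonZeroDivisors_iff_right.1 hϖ) _ h0)
  · exact Submodule.factor_surjective _
  · intro x
    induction x using Submodule.Quotient.induction_on with
    | H x =>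
      rw [Submodule.mapQ_apply, LinearMap.lsmul_apply, smul_eq_mul]
      change Submodule.factor _ (Submodule.mkQ _ (ϖ * x)) = 0
      rw [Submodule.factor_mk, Submodule.mkQ_apply, Submodule.Quotient.mk_eq_zero]
      exact Ideal.mem_span_singleton'.2 ⟨x, by ring⟩
  · intro y hy
    induction y using Submodule.Quotient.induction_on with
    | H y =>
      change Submodule.factor _ (Submodule.mkQ _ y) = 0 at hy
      rw [Submodule.factor_mk, Submodule.mkQ_apply, Submodule.Quotient.mk_eq_zero] at hy
      obtain ⟨r, rfl⟩ := Ideal.mem_span_singleton'.1 hy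
      refine ⟨Submodule.Quotient.mk r, ?_⟩
      rw [Submodule.mapQ_apply, LinearMap.lsmul_apply, smul_eq_mul, pow_one, mul_comm]

variable (ι T δ χ) in
/-- **Bockstein reduction.**  For `ϖ` a non-zero-divisor and `𝔭` prime: if `χ mod 𝔭` is supported
on a piece `H^i(X_{K(s)}, k/ϖ^{t+1})` (`t ≥ 0`) of the tower then it is supported on the piece
`H^i(X_{K(s)}, k/ϖ)` with `k/ϖ`-coefficients, in the same degree at the same level.
[cite: Brown1982CohomologyGroups, III §6 Prop. 6.1] -/
theorem supp_piece_one_of_supp_piece (h𝔭 : 𝔭.IsPrime) (hϖ : ϖ ∈ nonZeroDivisors k) (i s : ℕ) :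
    ∀ t : ℕ, (∀ P : FreeAlgebra k J,
      FreeAlgebra.lift k (fun j => towerHeckeFamily k ι T ϖ (δ j) (i, s, t + 1)) P = 0 →
        FreeAlgebra.lift k χ P ∈ 𝔭) →
    ∀ P : FreeAlgebra k J,
      FreeAlgebra.lift k (fun j => towerHeckeFamily k ι T ϖ (δ j) (i, s, 1)) P = 0 →
        FreeAlgebra.lift k χ P ∈ 𝔭
  | 0, h => h
  | t + 1, h => (supp_piece_or_of_supp_piece_succ ι T δ χ h𝔭 hϖ i s (t + 1) h).elim
      (supp_piece_one_of_supp_piece h𝔭 hϖ i s t) id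

variable (ι T δ χ) in
/-- **The pieces with `k/ϖ⁰ = 0` coefficients carry no support** (for a proper `𝔭`): they are zero
modules, on which `1 = 0`. [folklore] -/
theorem not_supp_piece_zero (h𝔭 : 𝔭 ≠ ⊤) (i s : ℕ) :
    ¬ ∀ P : FreeAlgebra k J,
      FreeAlgebra.lift k (fun j => towerHeckeFamily k ι T ϖ (δ j) (i, s, 0)) P = 0 →
        FreeAlgebra.lift k χ P ∈ 𝔭 := by
  intro h
  have hV : Limits.IsZero (ArithmeticQuotient.coeffRep k ι (T.level s) (modPow k ϖ 0)) := by
    rw [Rep.isZero_iff]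
    haveI : Subsingleton (modPow k ϖ 0) :=
      Ideal.Quotient.subsingleton_iff.mpr (by rw [pow_zero, Ideal.span_singleton_one])
    change Subsingleton ((𝒢 ⧸ T.level s) → modPow k ϖ 0)
    infer_instance
  have hz : Limits.IsZero (towerCohomology k ι T ϖ i s 0) :=
    (groupCohomology.functor k Γ i).map_isZero hV
  haveI : Subsingleton (towerCohomology k ι T ϖ i s 0) :=
    subsingleton_of_forall_eq 0 fun x => by
      simpa using congrArg (fun f => f.hom x) (hz.eq_of_src (𝟙 _) 0)
  exact not_nontrivial _ (nontrivial_of_supp _ h𝔭 h)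

/-! ### §5 Points of `Spf 𝕋(Kᵖ)` have residual support on one piece -/

/-- **A point of `Spf 𝕋(Kᵖ)` puts `χ mod 𝔭` in the support of ONE piece of the tower** (`𝔭` a prime
containing `ϖ`): stage `1` of `IsHeckePoint` (`isHeckePoint_iff_forall_freeAlgebra`) says that
`χ mod ϖ`, hence `χ mod 𝔭`, is supported on finitely many pieces `H^i(X_{K(s)}, k/ϖ^{t'})`, and support
on finitely many pieces forces support on one of them (`exists_supp_of_supp_finset`).
[cite: CalegariEmerton2011, §8] -/
theorem IsHeckePoint.exists_supp_piece (h : IsHeckePoint ι T ϖ δ χ) (h𝔭 : 𝔭.IsPrime) (hϖ𝔭 : ϖ ∈ 𝔭) :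
    ∃ z : TowerIndex, ∀ P : FreeAlgebra k J,
      FreeAlgebra.lift k (fun j => towerHeckeFamily k ι T ϖ (δ j) z) P = 0 →
        FreeAlgebra.lift k χ P ∈ 𝔭 := by
  rw [isHeckePoint_iff_forall_freeAlgebra] at h
  obtain ⟨I, hI⟩ := h 1
  have hI' : ∀ P : FreeAlgebra k J,
      (∀ z ∈ I, FreeAlgebra.lift k (fun j => towerHeckeFamily k ι T ϖ (δ j) z) P = 0) →
        FreeAlgebra.lift k χ P ∈ 𝔭 := by
    intro P hP
    have h1 := hI P (fun z hz => by rw [lift_towerHeckeFamily_apply]; exact hP z hz)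
    rw [pow_one] at h1
    exact (Ideal.span_singleton_le_iff_mem _).mpr hϖ𝔭 h1
  obtain ⟨z, -, hz⟩ := exists_supp_of_supp_finset
    (fun (z : TowerIndex) j => towerHeckeFamily k ι T ϖ (δ j) z) h𝔭 I hI'
  exact ⟨z, hz⟩

/-- **A point of `Spf 𝕋(Kᵖ)` puts `χ mod 𝔭` in the support of one piece WITH `k/ϖ`-COEFFICIENTS**:
for `ϖ` a non-zero-divisor lying in the prime `𝔭` and `χ` a point (`IsHeckePoint`), there are a
degree `i` and a level `K(s)` such that every non-commutative polynomial in the `T_{δ j}` vanishing on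
`H^i(X_{K(s)}, k/ϖ)` has `P(χ) ∈ 𝔭` — "`𝔪_χ ∈ Supp_𝕋 H^i(X_{K(s)}, k/ϖ)`" for `𝔭 = 𝔪`.
(`exists_supp_piece` + Bockstein reduction; the zero piece `t' = 0` is excluded.)
[cite: CalegariEmerton2011, §8] [cite: Brown1982CohomologyGroups, III §6 Prop. 6.1] -/
theorem IsHeckePoint.exists_supp_piece_one (h : IsHeckePoint ι T ϖ δ χ) (h𝔭 : 𝔭.IsPrime)
    (hϖ𝔭 : ϖ ∈ 𝔭) (hϖ : ϖ ∈ nonZeroDivisors k) :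
    ∃ i s : ℕ, ∀ P : FreeAlgebra k J,
      FreeAlgebra.lift k (fun j => towerHeckeFamily k ι T ϖ (δ j) (i, s, 1)) P = 0 →
        FreeAlgebra.lift k χ P ∈ 𝔭 := by
  obtain ⟨⟨i, s, t⟩, hz⟩ := IsHeckePoint.exists_supp_piece h h𝔭 hϖ𝔭
  cases t with
  | zero => exact absurd hz (not_supp_piece_zero ι T δ χ h𝔭.ne_top i s)
  | succ t => exact ⟨i, s, supp_piece_one_of_supp_piece ι T δ χ h𝔭 hϖ i s t hz⟩

end Tower

/-! ### §6 The crux: `k = ℤ̄₂`, `ϖ = 2`, `𝔭 = 𝔪` — residual support from the occurrence hypothesis of B -/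

section Crux

open scoped NumberField
open IsDedekindDomain

/-- Elements of `ℤ̄₂` (the valuation ring of `ℚ̄₂`) of norm `< 1` lie in the maximal ideal (a unit
`u` has `‖u‖ ‖u⁻¹‖ = 1` with both factors `≤ 1`). [folklore] -/
theorem mem_maximalIdeal_of_norm_lt_one (x : (PadicAlgCl.valued 2).v.valuationSubring)
    (hx : ‖(x : PadicAlgCl 2)‖ < 1) :
    x ∈ IsLocalRing.maximalIdeal ((PadicAlgCl.valued 2).v.valuationSubring) := by
  rw [IsLocalRing.mem_maximalIdeal, mem_nonunits_iff]
  rintro ⟨u, hu⟩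
  have hv : ∀ z : PadicAlgCl 2, Valued.v z ≤ 1 ↔ ‖z‖ ≤ 1 := fun z => by
    rw [PadicAlgCl.valuation_def, ← NNReal.coe_le_coe, coe_nnnorm, NNReal.coe_one]
  have h2 : ‖(((u⁻¹ : ((PadicAlgCl.valued 2).v.valuationSubring)ˣ) :
      (PadicAlgCl.valued 2).v.valuationSubring) : PadicAlgCl 2)‖ ≤ 1 :=
    (hv _).1 (((PadicAlgCl.valued 2).v.mem_valuationSubring_iff _).1 (Subtype.mem _))
  have hprod : ‖(x : PadicAlgCl 2)‖ * ‖(((u⁻¹ : ((PadicAlgCl.valued 2).v.valuationSubring)ˣ) :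
      (PadicAlgCl.valued 2).v.valuationSubring) : PadicAlgCl 2)‖ = 1 := by
    rw [← hu, ← norm_mul, ← MulMemClass.coe_mul, ← Units.val_mul, mul_inv_cancel, Units.val_one,
      OneMemClass.coe_one, norm_one]
  have hlt : ‖(x : PadicAlgCl 2)‖ * ‖(((u⁻¹ : ((PadicAlgCl.valued 2).v.valuationSubring)ˣ) :
      (PadicAlgCl.valued 2).v.valuationSubring) : PadicAlgCl 2)‖ < 1 :=
    calc _ ≤ ‖(x : PadicAlgCl 2)‖ * 1 := mul_le_mul_of_nonneg_left h2 (norm_nonneg _)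
      _ < 1 := by rw [mul_one]; exact hx
  exact absurd hprod (ne_of_lt hlt)

/-- `2 ∈ 𝔪_{ℤ̄₂}`. [folklore] -/
theorem two_mem_maximalIdeal_valuationSubring :
    ((2 : ℕ) : (PadicAlgCl.valued 2).v.valuationSubring) ∈
      IsLocalRing.maximalIdeal ((PadicAlgCl.valued 2).v.valuationSubring) :=
  (IsLocalRing.mem_maximalIdeal _).2 (mem_nonunits_iff.2 (not_isUnit_natCast_valuationSubring_padicAlgCl 2))

/-- `2` is a non-zero-divisor of `ℤ̄₂` (a domain of characteristic `0`). [folklore] -/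
theorem two_mem_nonZeroDivisors_valuationSubring :
    ((2 : ℕ) : (PadicAlgCl.valued 2).v.valuationSubring) ∈
      nonZeroDivisors ((PadicAlgCl.valued 2).v.valuationSubring) := by
  refine mem_nonZeroDivisors_of_ne_zero fun h0 => ?_
  have hnorm : ‖((2 : ℕ) : PadicAlgCl 2)‖ = ((2 : ℕ) : ℝ)⁻¹ := by
    rw [← map_natCast (algebraMap ℚ_[2] (PadicAlgCl 2)) 2]
    change ‖(((2 : ℕ) : ℚ_[2]) : PadicAlgCl 2)‖ = _
    rw [PadicAlgCl.norm_extends, Padic.norm_p]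
  have h2ne : ((2 : ℕ) : PadicAlgCl 2) ≠ 0 :=
    norm_ne_zero_iff.mp (by rw [hnorm]; positivity)
  apply h2ne
  have h0' := congrArg Subtype.val h0
  rwa [SubringClass.coe_natCast] at h0'

/-- **Residual support from an integral point congruent to `a` (the crux's setting).**  For
`Γ = GL₂(K) → GL₂(𝔸_K^∞)`, the `2`-power tower `(U₀ ∩ K((2)^r))_r` on a tame level `U₀`, the Hecke
family `(v, i) ↦ (t_{v,i+1})_f` over a type `S` of (good) places, `k = ℤ̄₂`, `ϖ = 2`: if `b` is a
point of `Spf 𝕋(U₀²)` (`IsHeckePoint`) and `‖b − a‖ < 1` value by value, then there are a degree `i`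
and a level `s` such that `a mod 𝔪` — for the Hansen data `a` of `σ`: the eigensystem of `σ̄` — is in
the Hecke support of the ONE Bianchi cohomology group `H^i(X_{U₀ ∩ K((2)^s)}, ℤ̄₂/2)`
(`= H^i(X_{U₀K(2^s)}, 𝔽₂) ⊗ ℤ̄₂`): every non-commutative polynomial in the `T_{v,1}, T_{v,2}` acting as
zero on it takes a value in `𝔪_{ℤ̄₂}` at `a`.  This is the hypothesis "`𝔪` is a maximal ideal of
`𝕋(U₀²)` in the support of `H^i(X_{U₀K_2(2^s)}, 𝒪/ϖ)`" with which the big `R = 𝕋` statements of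
Calegari–Geraghty and Gee–Newton begin. [cite: GeeNewton2020, §5.1, Conj. 60]
[cite: CalegariGeraghty2017, §1] -/
theorem crux_residualSupport : ∀ (K : Type) [Field K] [NumberField K]
    (U₀ : Subgroup (GL (Fin 2) (FiniteAdeleRing (𝓞 K) K))) (S₀ : Finset ℕ)
    (ϖ : ∀ v : HeightOneSpectrum (𝓞 K), (v.adicCompletion K)ˣ)
    (a b : {v : HeightOneSpectrum (𝓞 K) // ∀ ℓ ∈ S₀, ((ℓ : ℕ) : 𝓞 K) ∉ v.asIdeal} → ℕ →
      (PadicAlgCl.valued 2).v.valuationSubring),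
    (∀ j : {v : HeightOneSpectrum (𝓞 K) // ∀ ℓ ∈ S₀, ((ℓ : ℕ) : 𝓞 K) ∉ v.asIdeal} × Fin 2,
      ‖((b j.1 (j.2.val + 1) : (PadicAlgCl.valued 2).v.valuationSubring) : PadicAlgCl 2) -
        ((a j.1 (j.2.val + 1) : (PadicAlgCl.valued 2).v.valuationSubring) : PadicAlgCl 2)‖ < 1) →
    IsHeckePoint
      (Matrix.GeneralLinearGroup.map (algebraMap K (FiniteAdeleRing (𝓞 K) K)) :
        GL (Fin 2) K →* GL (Fin 2) (FiniteAdeleRing (𝓞 K) K))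
      (LevelTower.ofSeq U₀ (fun r : ℕ =>
        (principalCongruenceLevel 2 K (Ideal.span {((2 : ℕ) : 𝓞 K)} ^ r)).map (GLn.sndHom 2 K)))
      ((2 : ℕ) : (PadicAlgCl.valued 2).v.valuationSubring)
      (fun j : {v : HeightOneSpectrum (𝓞 K) // ∀ ℓ ∈ S₀, ((ℓ : ℕ) : 𝓞 K) ∉ v.asIdeal} × Fin 2 =>
        GLn.sndHom 2 K (heckeDiagAt 2 K j.1.1 (ϖ j.1.1) (j.2.val + 1)))
      (fun j => b j.1 (j.2.val + 1)) →
    ∃ i s : ℕ, ∀ P : FreeAlgebra ((PadicAlgCl.valued 2).v.valuationSubring)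
        ({v : HeightOneSpectrum (𝓞 K) // ∀ ℓ ∈ S₀, ((ℓ : ℕ) : 𝓞 K) ∉ v.asIdeal} × Fin 2),
      FreeAlgebra.lift ((PadicAlgCl.valued 2).v.valuationSubring)
        (fun j : {v : HeightOneSpectrum (𝓞 K) // ∀ ℓ ∈ S₀, ((ℓ : ℕ) : 𝓞 K) ∉ v.asIdeal} × Fin 2 =>
        towerHeckeFamily ((PadicAlgCl.valued 2).v.valuationSubring)
          (Matrix.GeneralLinearGroup.map (algebraMap K (FiniteAdeleRing (𝓞 K) K)) :
            GL (Fin 2) K →* GL (Fin 2) (FiniteAdeleRing (𝓞 K) K))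
          (LevelTower.ofSeq U₀ (fun r : ℕ =>
            (principalCongruenceLevel 2 K (Ideal.span {((2 : ℕ) : 𝓞 K)} ^ r)).map (GLn.sndHom 2 K)))
          ((2 : ℕ) : (PadicAlgCl.valued 2).v.valuationSubring)
          (GLn.sndHom 2 K (heckeDiagAt 2 K j.1.1 (ϖ j.1.1) (j.2.val + 1))) (i, s, 1)) P = 0 →
      FreeAlgebra.lift ((PadicAlgCl.valued 2).v.valuationSubring)
        (fun j : {v : HeightOneSpectrum (𝓞 K) // ∀ ℓ ∈ S₀, ((ℓ : ℕ) : 𝓞 K) ∉ v.asIdeal} × Fin 2 =>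
          a j.1 (j.2.val + 1)) P ∈
          IsLocalRing.maximalIdeal ((PadicAlgCl.valued 2).v.valuationSubring) := by
  intro K _ _ U₀ S₀ ϖ a b hab hpt
  have h𝔭 : (IsLocalRing.maximalIdeal ((PadicAlgCl.valued 2).v.valuationSubring)).IsPrime :=
    (IsLocalRing.maximalIdeal.isMaximal _).isPrime
  obtain ⟨i, s, hsupp⟩ := IsHeckePoint.exists_supp_piece_one hpt h𝔭
    two_mem_maximalIdeal_valuationSubring two_mem_nonZeroDivisors_valuationSubring
  exact ⟨i, s, supp_congr _ (fun j => mem_maximalIdeal_of_norm_lt_one _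
    (by rw [AddSubgroupClass.coe_sub]; exact hab j)) hsupp⟩

/-- **Residual support from the occurrence hypothesis of stub B (`stub_artinLift`), verbatim.**
The hypothesis of B — a tame level `U₀` (open, inside `GL₂(𝒪̂_K)`, containing every integral `g`
trivial at the bad places) carrying an `𝒪_{ℚ̄₂}`-valued point `b` of `Spf 𝕋(U₀²)` with `‖b − a‖ < 1`
at every good place — yields, at the SAME tame level, a degree `i` and a `2`-power level `s` with
`a mod 𝔪` in the Hecke support of `H^i(X_{U₀ ∩ K((2)^s)}, ℤ̄₂/2)`.  So B is a statement of the shape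
"[`𝔪_σ̄` in the support of one `H^i(X_{U₀K(2^s)}, 𝔽)`] ⇒ [the Artin point `a` of `σ` is a point of
`Spf 𝕋(U²)` for some tame level `U`]" — big `R = 𝕋` read at the Artin point, with no further input
hidden in its hypothesis. [cite: GeeNewton2020, §5.1, Conj. 60] [cite: CalegariGeraghty2017, §1] -/
theorem residualSupport_of_artinLift_hypotheses : ∀ (K : Type) [Field K] [NumberField K]
    (S₀ : Finset ℕ) (ϖ : ∀ v : HeightOneSpectrum (𝓞 K), (v.adicCompletion K)ˣ)
    (a : {v : HeightOneSpectrum (𝓞 K) // ∀ ℓ ∈ S₀, ((ℓ : ℕ) : 𝓞 K) ∉ v.asIdeal} → ℕ →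
      (PadicAlgCl.valued 2).v.valuationSubring),
    (∃ U₀ : Subgroup (GL (Fin 2) (FiniteAdeleRing (𝓞 K) K)),
      IsOpen (U₀ : Set (GL (Fin 2) (FiniteAdeleRing (𝓞 K) K))) ∧
      U₀ ≤ glFiniteIntegralLevel 2 K ∧
      (∀ g ∈ glFiniteIntegralLevel 2 K,
        (∀ v : HeightOneSpectrum (𝓞 K), ¬ (∀ ℓ ∈ S₀, ((ℓ : ℕ) : 𝓞 K) ∉ v.asIdeal) →
          ∀ i j : Fin 2, ((g : Matrix (Fin 2) (Fin 2) (FiniteAdeleRing (𝓞 K) K)) i j) v =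
            (1 : Matrix (Fin 2) (Fin 2) (v.adicCompletion K)) i j) → g ∈ U₀) ∧
      ∃ b : {v : HeightOneSpectrum (𝓞 K) // ∀ ℓ ∈ S₀, ((ℓ : ℕ) : 𝓞 K) ∉ v.asIdeal} → ℕ →
          (PadicAlgCl.valued 2).v.valuationSubring,
        (∀ j : {v : HeightOneSpectrum (𝓞 K) // ∀ ℓ ∈ S₀, ((ℓ : ℕ) : 𝓞 K) ∉ v.asIdeal} × Fin 2,
          ‖((b j.1 (j.2.val + 1) : (PadicAlgCl.valued 2).v.valuationSubring) : PadicAlgCl 2) -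
            ((a j.1 (j.2.val + 1) : (PadicAlgCl.valued 2).v.valuationSubring) : PadicAlgCl 2)‖ < 1) ∧
        IsHeckePoint
          (Matrix.GeneralLinearGroup.map (algebraMap K (FiniteAdeleRing (𝓞 K) K)) :
            GL (Fin 2) K →* GL (Fin 2) (FiniteAdeleRing (𝓞 K) K))
          (LevelTower.ofSeq U₀ (fun r : ℕ =>
            (principalCongruenceLevel 2 K (Ideal.span {((2 : ℕ) : 𝓞 K)} ^ r)).map (GLn.sndHom 2 K)))
          ((2 : ℕ) : (PadicAlgCl.valued 2).v.valuationSubring)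
          (fun j : {v : HeightOneSpectrum (𝓞 K) // ∀ ℓ ∈ S₀, ((ℓ : ℕ) : 𝓞 K) ∉ v.asIdeal} × Fin 2 =>
            GLn.sndHom 2 K (heckeDiagAt 2 K j.1.1 (ϖ j.1.1) (j.2.val + 1)))
          (fun j => b j.1 (j.2.val + 1))) →
    ∃ U₀ : Subgroup (GL (Fin 2) (FiniteAdeleRing (𝓞 K) K)),
      IsOpen (U₀ : Set (GL (Fin 2) (FiniteAdeleRing (𝓞 K) K))) ∧
      U₀ ≤ glFiniteIntegralLevel 2 K ∧
      (∀ g ∈ glFiniteIntegralLevel 2 K,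
        (∀ v : HeightOneSpectrum (𝓞 K), ¬ (∀ ℓ ∈ S₀, ((ℓ : ℕ) : 𝓞 K) ∉ v.asIdeal) →
          ∀ i j : Fin 2, ((g : Matrix (Fin 2) (Fin 2) (FiniteAdeleRing (𝓞 K) K)) i j) v =
            (1 : Matrix (Fin 2) (Fin 2) (v.adicCompletion K)) i j) → g ∈ U₀) ∧
      ∃ i s : ℕ, ∀ P : FreeAlgebra ((PadicAlgCl.valued 2).v.valuationSubring)
          ({v : HeightOneSpectrum (𝓞 K) // ∀ ℓ ∈ S₀, ((ℓ : ℕ) : 𝓞 K) ∉ v.asIdeal} × Fin 2),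
        FreeAlgebra.lift ((PadicAlgCl.valued 2).v.valuationSubring)
          (fun j : {v : HeightOneSpectrum (𝓞 K) // ∀ ℓ ∈ S₀, ((ℓ : ℕ) : 𝓞 K) ∉ v.asIdeal} × Fin 2 =>
            towerHeckeFamily ((PadicAlgCl.valued 2).v.valuationSubring)
              (Matrix.GeneralLinearGroup.map (algebraMap K (FiniteAdeleRing (𝓞 K) K)) :
                GL (Fin 2) K →* GL (Fin 2) (FiniteAdeleRing (𝓞 K) K))
              (LevelTower.ofSeq U₀ (fun r : ℕ =>
                (principalCongruenceLevel 2 K (Ideal.span {((2 : ℕ) : 𝓞 K)} ^ r)).map (GLn.sndHom 2 K)))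
              ((2 : ℕ) : (PadicAlgCl.valued 2).v.valuationSubring)
              (GLn.sndHom 2 K (heckeDiagAt 2 K j.1.1 (ϖ j.1.1) (j.2.val + 1))) (i, s, 1)) P = 0 →
        FreeAlgebra.lift ((PadicAlgCl.valued 2).v.valuationSubring)
          (fun j : {v : HeightOneSpectrum (𝓞 K) // ∀ ℓ ∈ S₀, ((ℓ : ℕ) : 𝓞 K) ∉ v.asIdeal} × Fin 2 =>
            a j.1 (j.2.val + 1)) P ∈
          IsLocalRing.maximalIdeal ((PadicAlgCl.valued 2).v.valuationSubring) := by
  intro K _ _ S₀ ϖ a hB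
  obtain ⟨U₀, hU₀o, hU₀le, hU₀3, b, hab, hpt⟩ := hB
  exact ⟨U₀, hU₀o, hU₀le, hU₀3, crux_residualSupport K U₀ S₀ ϖ a b hab hpt⟩

end Crux

end Summit.Langlands.Langlands.Theorems.TwoAdicBianchiProModularityLevel

end
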